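/-
Copyright (c) 2026 the pub-hodgecm-mathlib formalisation cell (harness21).  Prover seat hodgecm-mathlib-K2E4-p10 (g5), Track B ∕ K2-LIT, h413 =
`stmt-HodgeConjecture-24833`, ENGINE E1, campaign «EIS-WHITTAKER-3», WAVE 2 letter «W-hWbd₃» (dealer K2E1-plan (g5) DEAL (4) 2026-09-04T08:27:09Z), FILE C1₃-inert of the census
08:28Z: ONE ENTIRE PACKAGE PER INERT UNRAMIFIED PLACE for the finite Whittaker factor of the spherical section of `U(2,1)_{L∕L⁺}` (★ D-W1 p858537 packaged as ★ N=2 C1 p858471 §1).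
-/
import Summits.HodgeConjecture.HodgeConjecture.Theorems.K2E1FiniteWhittakerInertU3          -- ★ p858537 D-W1 (this seat): `integral_inertWhittaker_eq_closedForm ∕ _eq_zero_of_not_mem`, `differentiable_inertWhittakerClosedForm`, `norm_natCast_cpow_neg_lt_one`
import Summits.HodgeConjecture.HodgeConjecture.Theorems.K2E1LocalWhittakerContinuationU2     -- ★ p858451 A (K2E3-p12 g6): `exists_nat_mem_primePowBall_not_mem`, `nat_unique_of_mem_primePowBall_not_mem`, `toReal_measure_integers_eq`
import Literature.NumberTheory.LFunctions.LehmanCriticalLineNumerics                         -- ★ `CritLineCert.norm_natCast_cpow_neg_le_one` (`‖n^{−s}‖ ≤ 1`, reused per dedup)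
import HarnessLib

/-!
# K2·E1 — `K2E1LocalWhittakerPackageU3` («EIS-WHITTAKER-3», letter «W-hWbd₃», FILE C1₃-inert): ONE ENTIRE PACKAGE PER INERT UNRAMIFIED PLACE WITH THE BOUND `4(n+1)` ON `Re s ≥ 1`

Track B ∕ K2-LIT, crux h413 = `stmt-HodgeConjecture-24833`, route of record `HCCMUnconditional`; cell `hodgecm-mathlib`, squad K2, ENGINE E1 (campaign «EIS-WHITTAKER-3», WAVE 2).
Prover seat `hodgecm-mathlib-K2E4-p10` (g5).  THEOREMS ONLY (no `def`, no `instance`, no notation, no named-fact hypothesis, no `sorry`; default heartbeats); lane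
`--supports stmt-HodgeConjecture-24833 --as helper` (count-neutral).  Closes no socket.  GENERIC: two non-archimedean local fields `E ⊇ F` with `q_E = q_F²` (`= (L_w, L⁺_v)` at an inert
unramified place), ANY Haar measures `μE`, `μF`, ANY continuous `ψ : AddChar E Circle` of conductor exponent `m`, ANY frequency `η : E`.

THE MATHEMATICS [Tate1950, §2.5; Casselman1980, §3 Thm. 3.1; Garrett2018, §2.8].  The N = 3 twin of ★ C1 `K2E1LocalWhittakerPackageU2.exists_entire_localWhittaker_unramified`: the inert
Whittaker local factor `J(η, s) = ∫_E (∫_F max(1, ‖X‖_E, |t|_F)^{−2s} dμ_F) ψ(Xη) dμ_E` of ★ D-W1 equals, on the window `Re s > 1` and for `η ∈ 𝔭_E^{m+n} ∖ 𝔭_E^{m+n+1}`, the ENTIRE polynomial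
`μ_F(𝒪_F)μ_E(𝒪_E)·(1 − q^{−2s})(1 + q^{−(2s−1)})·Σ_{k=0}^{n}(q_E^{−(2s−1)}q_E)^k` (★ `integral_inertWhittaker_eq_closedForm`), and vanishes for `η ∉ 𝔭_E^m` (★ `…_eq_zero_of_not_mem`).  We PACKAGE
this η-uniformly: for EVERY `η` there is `W^c : ℂ → ℂ` ENTIRE with (i) `η ≠ 0 ⟹ μ_F(𝒪_F)⁻¹μ_E(𝒪_E)⁻¹·J(η, s) = W^c(s)` for `Re s > 1`; (ii) `η ∈ 𝔭^{m+n} ∖ 𝔭^{m+n+1} ⟹ ‖W^c(s)‖ ≤ 4(n+1)` on the CLOSED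
half-plane `Re s ≥ 1` (`‖1 − q^{−2s}‖ ≤ 2`, `‖1 + q^{−(2s−1)}‖ ≤ 2`, each `‖(q_E^{−(2s−1)}q_E)^k‖ = q_E^{k(2−2Re s)} ≤ 1`); (iii) `η ∉ 𝔭^m ⟹ W^c = 0`.  Multiplied over the `ξ`-dependent set
`S(ξ)` the `(n_w+1)` give the divisor-type growth `≤ C·(1+‖ξ_∞‖)^{2[L:ℚ]}` of ★ #1b (generic `K := L`) — the box bound of the future C2₃; the constant `4` per place is absorbed exactly as
★ C1's `B_v` (only the places of a fixed finite `S₀` can carry it once C2₃ normalises by the unit value off `S(ξ)`).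

* §1 (`‖q^{−w}‖ ≤ 1` is ★ `CritLineCert.norm_natCast_cpow_neg_le_one`) **`norm_inertUnitFactors_le_four`** — `‖(1 − q^{−2s})(1 + q^{−(2s−1)})‖ ≤ 4` on `Re s ≥ ½`; **`norm_sum_pow_le_succ`** — `‖Σ_{k≤n}(q_E^{−(2s−1)}q_E)^k‖ ≤ n+1` on `Re s ≥ 1`;
  **`norm_inertWhittakerClosedForm_le`** — `‖closed form∕(μμ′)‖ ≤ 4(n+1)` on `Re s ≥ 1`.
* §2 HEAD **`exists_entire_inertWhittakerPackage`** — the package (i)(ii)(iii) above (★ C1 :60 shape with `½ ↦ 1`, `2(n+1) ↦ 4(n+1)`).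
* §3 the number-field reading `exists_entire_inertWhittakerPackage_adicCompletion` at `(E, F) = (L_w, K_v)` with `N(w) = N(v)²`, normaliser spelled `ν(𝒪)` (★ `toReal_measure_integers_eq`).
HONEST LABEL: HC_CM is proved only modulo the 7 printed citations (2 remaining named inputs: hLiu418 = `stmt-HodgeConjecture-24832`, h413 = `stmt-HodgeConjecture-24833`) until rung 0
closes; this file asserts no named fact and closes no socket; count-neutral.

## References
* [Tate1950] J. Tate, *Fourier analysis in number fields and Hecke's zeta-functions* (1950): §2.5.
* [Casselman1980] W. Casselman, *The unramified principal series of p-adic groups I*, Compositio Math. 40 (1980): §3, Thm. 3.1.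
* [Garrett2018] P. Garrett, *Modern Analysis of Automorphic Forms by Example* 1 (2018): §2.8 (divisor-type bounds for Fourier coefficients).
-/

set_option autoImplicit false
set_option linter.dupNamespace false -- the mandated namespace repeats `HodgeConjecture.HodgeConjecture`

noncomputable section

open MeasureTheory Filter Topology Set NumberField IsDedekindDomain
open scoped NNReal ENNReal
open Literature.NumberTheory.GaloisRepresentations.IsNonarchimedeanLocalField
open Literature.NumberTheory.Automorphic Literature.NumberTheory.Automorphic.LocalFieldHaar
open Summit.HodgeConjecture.HodgeConjecture.Cruxes.HLiu418.K2LiuGKRankOneIntegral (one_lt_residueFieldCard_real)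
open Literature.NumberTheory.LFunctions.CritLineCert (norm_natCast_cpow_neg_le_one)
open Summit.HodgeConjecture.HodgeConjecture.Cruxes.H413.K2E1FiniteWhittakerInertU3
open Summit.HodgeConjecture.HodgeConjecture.Cruxes.H413.K2E1LocalWhittakerContinuationU2 (exists_nat_mem_primePowBall_not_mem nat_unique_of_mem_primePowBall_not_mem toReal_measure_integers_eq)

namespace Summit.HodgeConjecture.HodgeConjecture.Cruxes.H413.K2E1LocalWhittakerPackageU3

/-! ## §1 Norm bounds for the entire closed form on `Re s ≥ 1` -/

/-- **`‖(1 − q^{−2s})(1 + q^{−(2s−1)})‖ ≤ 4`** for `q ≥ 1`, `Re s ≥ ½` (each factor has norm `≤ 2`). [folklore] -/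
theorem norm_inertUnitFactors_le_four {q : ℕ} (hq : 1 ≤ q) {s : ℂ} (hs : 1 / 2 ≤ s.re) :
    ‖(1 - (q : ℂ) ^ (-(2 * s))) * (1 + (q : ℂ) ^ (-(2 * s - 1)))‖ ≤ 4 := by
  have h2 : (2 * s).re = 2 * s.re := by simp [Complex.mul_re]
  have ha : ‖(q : ℂ) ^ (-(2 * s))‖ ≤ 1 := norm_natCast_cpow_neg_le_one hq (by rw [h2]; linarith)
  have hb : ‖(q : ℂ) ^ (-(2 * s - 1))‖ ≤ 1 := norm_natCast_cpow_neg_le_one hq (by rw [Complex.sub_re, h2, Complex.one_re]; linarith)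
  have h1 : ‖(1 : ℂ) - (q : ℂ) ^ (-(2 * s))‖ ≤ 2 := (norm_sub_le _ _).trans (by rw [norm_one]; linarith)
  have h1' : ‖(1 : ℂ) + (q : ℂ) ^ (-(2 * s - 1))‖ ≤ 2 := (norm_add_le _ _).trans (by rw [norm_one]; linarith)
  rw [norm_mul]
  nlinarith [norm_nonneg ((1 : ℂ) - (q : ℂ) ^ (-(2 * s))), norm_nonneg ((1 : ℂ) + (q : ℂ) ^ (-(2 * s - 1)))]

/-- **`‖Σ_{k=0}^{n} (q^{−(2s−1)}·q)^k‖ ≤ n + 1`** for `q ≥ 1`, `Re s ≥ 1` (each term has norm `q^{k(2−2Re s)} ≤ 1`). [folklore] -/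
theorem norm_sum_pow_le_succ {q : ℕ} (hq : 1 ≤ q) {s : ℂ} (hs : 1 ≤ s.re) (n : ℕ) :
    ‖∑ k ∈ Finset.range (n + 1), ((q : ℂ) ^ (-(2 * s - 1)) * (q : ℂ)) ^ k‖ ≤ (n : ℝ) + 1 := by
  have hq0 : (q : ℂ) ≠ 0 := by exact_mod_cast (show q ≠ 0 by omega)
  have h2 : (2 * s).re = 2 * s.re := by simp [Complex.mul_re]
  -- `q^{−(2s−1)}·q = q^{−(2s−2)}` has norm `≤ 1`
  have hc : ‖(q : ℂ) ^ (-(2 * s - 1)) * (q : ℂ)‖ ≤ 1 := by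
    have : (q : ℂ) ^ (-(2 * s - 1)) * (q : ℂ) = (q : ℂ) ^ (-(2 * s - 2)) := by
      rw [show (-(2 * s - 2) : ℂ) = -(2 * s - 1) + 1 by ring, Complex.cpow_add _ _ hq0, Complex.cpow_one]
    rw [this]
    exact norm_natCast_cpow_neg_le_one hq (by rw [Complex.sub_re, h2]; norm_num; linarith)
  calc ‖∑ k ∈ Finset.range (n + 1), ((q : ℂ) ^ (-(2 * s - 1)) * (q : ℂ)) ^ k‖
      ≤ ∑ k ∈ Finset.range (n + 1), ‖((q : ℂ) ^ (-(2 * s - 1)) * (q : ℂ)) ^ k‖ := norm_sum_le _ _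
    _ ≤ ∑ _k ∈ Finset.range (n + 1), (1 : ℝ) := Finset.sum_le_sum fun k _ => by
        rw [norm_pow]; exact pow_le_one₀ (norm_nonneg _) hc
    _ = (n : ℝ) + 1 := by rw [Finset.sum_const, Finset.card_range, nsmul_eq_mul, mul_one]; push_cast; ring

variable {E F : Type*} [Field E] [ValuativeRel E] [TopologicalSpace E] [IsNonarchimedeanLocalField E]
  [Field F] [ValuativeRel F] [TopologicalSpace F] [IsNonarchimedeanLocalField F]

/-- **THE NORMALISED CLOSED FORM IS BOUNDED BY `4(n+1)` ON `Re s ≥ 1`**: `‖(1 − q_F^{−2s})(1 + q_F^{−(2s−1)})·Σ_{k=0}^{n}(q_E^{−(2s−1)}q_E)^k‖ ≤ 4(n+1)`.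
[cite: Garrett2018, §2.8] [cite: Tate1950, §2.5] -/
theorem norm_inertWhittakerClosedForm_le {s : ℂ} (hs : 1 ≤ s.re) (n : ℕ) :
    ‖(1 - (residueFieldCard F : ℂ) ^ (-(2 * s))) * (1 + (residueFieldCard F : ℂ) ^ (-(2 * s - 1))) *
        ∑ k ∈ Finset.range (n + 1), ((residueFieldCard E : ℂ) ^ (-(2 * s - 1)) * (residueFieldCard E : ℂ)) ^ k‖ ≤ 4 * ((n : ℝ) + 1) := by
  rw [norm_mul]
  exact mul_le_mul (norm_inertUnitFactors_le_four (one_lt_residueFieldCard F).le (by linarith)) (norm_sum_pow_le_succ (one_lt_residueFieldCard E).le hs n)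
    (norm_nonneg _) (by norm_num)

/-! ## §2 The η-uniform ENTIRE package at an inert unramified place -/

variable [MeasurableSpace F] [BorelSpace F] (μF : Measure F) [μF.IsAddHaarMeasure]
  [MeasurableSpace E] [BorelSpace E] (μE : Measure E) [μE.IsAddHaarMeasure]

/-- **THE INERT WHITTAKER FACTOR AS AN ENTIRE PACKAGE, UNIFORM IN THE FREQUENCY `η`** (`q_E = q_F²`, `ψ` continuous of conductor exponent `m`, Haar `μE`, `μF`).  For EVERY `η ∈ E` there
is `W^c : ℂ → ℂ` with: `W^c` ENTIRE; (i) if `η ≠ 0` then for `Re s > 1`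
`μ_F(𝒪_F)⁻¹·μ_E(𝒪_E)⁻¹·∫_E (∫_F max(1,‖X‖_E,|t|_F)^{−2s} dμ_F) ψ(Xη) dμ_E = W^c(s)`; (ii) for every `n` with `η ∈ 𝔭_E^{m+n} ∖ 𝔭_E^{m+n+1}`, `‖W^c(s)‖ ≤ 4(n+1)` on `Re s ≥ 1`;
(iii) if `η ∉ 𝔭_E^m` then `W^c = 0`.  (`W^c := (1 − q^{−2s})(1 + q^{−(2s−1)})Σ_{k≤n_η}(q_E^{−(2s−1)}q_E)^k` on the support — ★ D-W1 closed form ∕ vanishing ∕ entirety + §1; the N = 3 twin of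
★ C1 `exists_entire_localWhittaker_unramified`.) [cite: Tate1950, §2.5] [cite: Casselman1980, §3 Thm. 3.1] [cite: Garrett2018, §2.8] -/
theorem exists_entire_inertWhittakerPackage (hq : residueFieldCard E = residueFieldCard F ^ 2) {ψ : AddChar E Circle} (hψ : Continuous ψ) {m : ℤ}
    (hm : ψ.HasConductorExp m) (η : E) :
    ∃ Wc : ℂ → ℂ, Differentiable ℂ Wc ∧
      (η ≠ 0 → ∀ s : ℂ, 1 < s.re →
        ((μF.real (primePowBall F 0))⁻¹ : ℂ) * ((μE.real (primePowBall E 0))⁻¹ : ℂ) *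
          ∫ X, (∫ t, (((max 1 (max ((normAbs E X : ℝ≥0) : ℝ) ((normAbs F t : ℝ≥0) : ℝ)) : ℝ) : ℂ) ^ (-(2 * s))) ∂μF) * ((ψ (X * η) : Circle) : ℂ) ∂μE = Wc s) ∧
      (∀ n : ℕ, η ∈ primePowBall E (m + n) → η ∉ primePowBall E (m + n + 1) → ∀ s : ℂ, 1 ≤ s.re → ‖Wc s‖ ≤ 4 * ((n : ℝ) + 1)) ∧
      (η ∉ primePowBall E m → Wc = 0) := by
  have hμF0 : 0 < μF.real (primePowBall F 0) := measureReal_primePowBall_pos μF 0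
  have hμE0 : 0 < μE.real (primePowBall E 0) := measureReal_primePowBall_pos μE 0
  have hμF0' : ((μF.real (primePowBall F 0) : ℝ) : ℂ) ≠ 0 := by exact_mod_cast hμF0.ne'
  have hμE0' : ((μE.real (primePowBall E 0) : ℝ) : ℂ) ≠ 0 := by exact_mod_cast hμE0.ne'
  by_cases hsupp : η ∈ primePowBall E m
  · by_cases hη : η = 0
    · refine ⟨0, differentiable_const 0, fun h => (h hη).elim, fun n _ hn1 => ?_, fun _ => rfl⟩
      exact (hn1 (hη ▸ zero_mem_primePowBall _)).elim
    · obtain ⟨n₀, hn₀, hn₀'⟩ := exists_nat_mem_primePowBall_not_mem hη hsupp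
      refine ⟨fun s => (1 - (residueFieldCard F : ℂ) ^ (-(2 * s))) * (1 + (residueFieldCard F : ℂ) ^ (-(2 * s - 1))) *
          ∑ k ∈ Finset.range (n₀ + 1), ((residueFieldCard E : ℂ) ^ (-(2 * s - 1)) * (residueFieldCard E : ℂ)) ^ k, ?_, fun _ s hs => ?_,
        fun n hn hn1 s hs => ?_, fun h => (h hsupp).elim⟩
      · simpa only [one_mul] using differentiable_inertWhittakerClosedForm (E := E) (F := F) 1 n₀
      · rw [integral_inertWhittaker_eq_closedForm μF μE hq hψ hm hn₀ hn₀' hs]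
        push_cast
        field_simp
      · have hnn : n = n₀ := nat_unique_of_mem_primePowBall_not_mem hn hn1 hn₀ hn₀'
        subst hnn
        exact norm_inertWhittakerClosedForm_le hs n
  · refine ⟨0, differentiable_const 0, fun _ s hs => ?_, fun n hn _ => (hsupp (primePowBall_antitone (by omega) hn)).elim, fun _ => rfl⟩
    rw [integral_inertWhittaker_eq_zero_of_not_mem μF μE hq hψ hm hsupp hs, mul_zero]
    rfl

/-! ## §3 The number-field reading: `(E, F) = (L_w, K_v)` with `N(w) = N(v)²`, normaliser `ν(𝒪)` -/

section Place

variable {K L : Type} [Field K] [NumberField K] [Field L] [NumberField L]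
  (v : HeightOneSpectrum (𝓞 K)) (w : HeightOneSpectrum (𝓞 L))
  [MeasurableSpace (v.adicCompletion K)] [BorelSpace (v.adicCompletion K)] (νv : Measure (v.adicCompletion K)) [νv.IsAddHaarMeasure]
  [MeasurableSpace (w.adicCompletion L)] [BorelSpace (w.adicCompletion L)] (νw : Measure (w.adicCompletion L)) [νw.IsAddHaarMeasure]

/-- **THE PACKAGE AT A PLACE.**  For finite places `v` of `K` and `w` of `L` with `N(w) = N(v)²` (the case `K = L⁺`, `w ∣ v` non-split and unramified in the CM field `L`: ★
`Rogawski1990.absNorm_placesOver_eq_sq_of_nonsplit_of_isUnramifiedIn`), Haar measures `ν_v`, `ν_w`, a continuous `ψ_w : AddChar L_w Circle` of conductor exponent `m_w` and any `η ∈ L_w`,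
the package of §2 with the normalisers spelled `ν_v(𝒪_v)⁻¹·ν_w(𝒪_w)⁻¹` (★ `toReal_measure_integers_eq`). [cite: Tate1950, §2.5] [cite: Casselman1980, §3 Thm. 3.1] -/
theorem exists_entire_inertWhittakerPackage_adicCompletion (hq : w.residueCard = v.residueCard ^ 2) {ψ : AddChar (w.adicCompletion L) Circle} (hψ : Continuous ψ)
    {m : ℤ} (hm : ψ.HasConductorExp m) (η : w.adicCompletion L) :
    ∃ Wc : ℂ → ℂ, Differentiable ℂ Wc ∧
      (η ≠ 0 → ∀ s : ℂ, 1 < s.re →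
        (((νv (v.adicCompletionIntegers K : Set (v.adicCompletion K))).toReal⁻¹ : ℝ) : ℂ) *
          (((νw (w.adicCompletionIntegers L : Set (w.adicCompletion L))).toReal⁻¹ : ℝ) : ℂ) *
          ∫ X, (∫ t, (((max 1 (max ((normAbs (w.adicCompletion L) X : ℝ≥0) : ℝ) ((normAbs (v.adicCompletion K) t : ℝ≥0) : ℝ)) : ℝ) : ℂ) ^ (-(2 * s))) ∂νv) *
            ((ψ (X * η) : Circle) : ℂ) ∂νw = Wc s) ∧
      (∀ n : ℕ, η ∈ primePowBall (w.adicCompletion L) (m + n) → η ∉ primePowBall (w.adicCompletion L) (m + n + 1) → ∀ s : ℂ, 1 ≤ s.re → ‖Wc s‖ ≤ 4 * ((n : ℝ) + 1)) ∧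
      (η ∉ primePowBall (w.adicCompletion L) m → Wc = 0) := by
  have hq' : residueFieldCard (w.adicCompletion L) = residueFieldCard (v.adicCompletion K) ^ 2 := by
    rw [residueFieldCard_adicCompletion_eq, residueFieldCard_adicCompletion_eq, hq]
  obtain ⟨Wc, hd, hi, hb, hz⟩ := exists_entire_inertWhittakerPackage νv νw hq' hψ hm η
  refine ⟨Wc, hd, fun hη s hs => ?_, hb, hz⟩
  rw [← hi hη s hs, toReal_measure_integers_eq, toReal_measure_integers_eq]
  push_cast
  ring

end Place

end Summit.HodgeConjecture.HodgeConjecture.Cruxes.H413.K2E1LocalWhittakerPackageU3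

end
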